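import Mathlib
import Literature.Analysis.FluidPDE.HydrodynamicImpulse
import HarnessLib

/-!
# Hydrodynamic impulse of integrable velocity fields, II: the vector identity
# `∫ x × curl v dx = 2 ∫ v dx` (Saffman (3.2.11)) and `I = ½∫ x × ω = 0` for integrable divergence-free fields

Sequel of `HydrodynamicImpulse.lean` (which proves the zero-flux theorem `∫ V = 0`, Saffman (3.2.15), and the
AXIAL component of (3.2.11) in the tree's `swirl (curl v)` notation). Here all three components: for every
`i`, the flux field `Gᵢ(y) = ⟪y, v(y)⟫ eᵢ − vᵢ(y) y` has `div Gᵢ = (x × curl v)ᵢ − 2vᵢ` pointwise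
(`divergence_impulseFlux_eq`), hence for `v ∈ C¹` with `v` and `x × curl v` integrable
`∫ (x × curl v)ᵢ = 2∫ vᵢ` (`integral_cross_curl_apply_eq_two_mul_integral`), in vector form
`∫ x × curl v = 2 ∫ v` (`integral_cross_curl_eq_two_smul_integral`, the tree's `cross`), and for a
divergence-free such field the hydrodynamic impulse `I = ½ ∫ x × curl v` VANISHES
(`integral_cross_curl_eq_zero_of_isDivFree`; Saffman (3.2.13) + (3.2.15)). Engine: the tree's
`PineauVicol2026.integral_divergence_eq_zero_of_integrable_div` (`∫ div G = 0` for `div G ∈ L¹`,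
`‖G‖/(1+|x|) ∈ L¹`; here `‖Gᵢ‖ ≤ 2|x|‖v‖`). Not here: the dynamics `dI/dt = ∫ F dx` (Saffman (3.2.9)).

References: P. G. Saffman, *Vortex Dynamics*, Cambridge Univ. Press (1992), §3.2, eqs. (8), (11), (13), (15)
[cite: Saffman1992, §3.2 (3.2.8)–(3.2.15)]; A. J. Majda, A. L. Bertozzi (2002), §1.7 (1.68)
[cite: MajdaBertozziCUP2002, §1.7 Prop. 1.12].
-/

noncomputable section

open MeasureTheory Filter Set Function
open scoped RealInnerProductSpace Topology

namespace Literature.Analysis.FluidPDE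

section Vector

variable {v : (EuclideanSpace ℝ (Fin 3)) → (EuclideanSpace ℝ (Fin 3))}

/-- A coordinate of a differentiable field: `D(vᵢ)(x) = πᵢ ∘ Dv(x)` (copy for this section). [folklore] -/
private theorem hasFDerivAt_apply_coord'' {x : EuclideanSpace ℝ (Fin 3)} (hv : DifferentiableAt ℝ v x)
    (i : Fin 3) :
    HasFDerivAt (fun y => v y i)
      ((EuclideanSpace.proj i : EuclideanSpace ℝ (Fin 3) →L[ℝ] ℝ).comp (fderiv ℝ v x)) x :=
  (EuclideanSpace.proj i : EuclideanSpace ℝ (Fin 3) →L[ℝ] ℝ).hasFDerivAt.comp x hv.hasFDerivAt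

/-- A coordinate of an integrable field is integrable (copy for this file). [folklore] -/
private theorem integrable_apply_coord_vec3' (hint : Integrable v) (i : Fin 3) :
    Integrable fun x => v x i :=
  (EuclideanSpace.proj i : EuclideanSpace ℝ (Fin 3) →L[ℝ] ℝ).integrable_comp hint

/-- **The pointwise form of Saffman's (3.2.11), every component.** For `v` differentiable at `x` and
`i ∈ {0,1,2}`, the flux field `Gᵢ(y) = ⟪y, v(y)⟫ eᵢ − vᵢ(y) y` has
`div Gᵢ (x) = (x × curl v)ᵢ − 2 vᵢ(x)` — since `(x × ω)ᵢ = Σⱼ xⱼ (∂ᵢvⱼ − ∂ⱼvᵢ)`,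
`div (⟪x,v⟫ eᵢ) = ∂ᵢ⟪x, v⟫ = vᵢ + Σⱼ xⱼ∂ᵢvⱼ` and `div (vᵢ x) = 3vᵢ + Σⱼ xⱼ∂ⱼvᵢ`.
[cite: Saffman1992, §3.2 eq. (3.2.11)] -/
theorem divergence_impulseFlux_eq {x : EuclideanSpace ℝ (Fin 3)} (hv : DifferentiableAt ℝ v x) (i : Fin 3) :
    VectorCalculus.divergence (fun y : EuclideanSpace ℝ (Fin 3) =>
        ⟪y, v y⟫ • (EuclideanSpace.single i (1 : ℝ) : EuclideanSpace ℝ (Fin 3)) - (v y i) • y) x =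
      cross x (curl v x) i - 2 * v x i := by
  have h1 : HasFDerivAt (fun y : EuclideanSpace ℝ (Fin 3) => ⟪y, v y⟫) _ x :=
    (hasFDerivAt_id x).inner ℝ hv.hasFDerivAt
  have h2 : HasFDerivAt (fun y : EuclideanSpace ℝ (Fin 3) => (v y i) • y) _ x :=
    (hasFDerivAt_apply_coord'' hv i).smul (hasFDerivAt_id x)
  have hG : HasFDerivAt (fun y : EuclideanSpace ℝ (Fin 3) =>
      ⟪y, v y⟫ • (EuclideanSpace.single i (1 : ℝ) : EuclideanSpace ℝ (Fin 3)) - (v y i) • y) _ x :=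
    (h1.smul_const _).sub h2
  rw [divergence_eq_sum_inner_fderiv (EuclideanSpace.basisFun (Fin 3) ℝ), hG.fderiv]
  fin_cases i <;>
    simp [Fin.sum_univ_three, inner_sub_right, inner_add_right, inner_smul_right, cross, cross_apply,
      FluidPDE.curl, PiLp.inner_apply] <;> ring

/-- Size of the flux field: `‖⟪y, v y⟫ eᵢ − vᵢ(y) y‖ ≤ 2 ‖y‖ ‖v y‖`. [folklore] -/
private theorem norm_impulseFlux_le (v : EuclideanSpace ℝ (Fin 3) → EuclideanSpace ℝ (Fin 3))
    (i : Fin 3) (y : EuclideanSpace ℝ (Fin 3)) :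
    ‖⟪y, v y⟫ • (EuclideanSpace.single i (1 : ℝ) : EuclideanSpace ℝ (Fin 3)) - (v y i) • y‖ ≤
      2 * (‖y‖ * ‖v y‖) := by
  have hs : ‖(EuclideanSpace.single i (1 : ℝ) : EuclideanSpace ℝ (Fin 3))‖ = 1 := by simp
  have hvi : |v y i| ≤ ‖v y‖ := by simpa using PiLp.norm_apply_le (v y) i
  have hA : ‖⟪y, v y⟫ • (EuclideanSpace.single i (1 : ℝ) : EuclideanSpace ℝ (Fin 3))‖ ≤ ‖y‖ * ‖v y‖ := by
    rw [norm_smul, hs, mul_one]; exact norm_inner_le_norm y (v y)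
  have hB : ‖(v y i) • y‖ ≤ ‖y‖ * ‖v y‖ := by
    rw [norm_smul, Real.norm_eq_abs, mul_comm]; gcongr
  calc _ ≤ ‖⟪y, v y⟫ • (EuclideanSpace.single i (1 : ℝ) : EuclideanSpace ℝ (Fin 3))‖ + ‖(v y i) • y‖ :=
        norm_sub_le _ _
    _ ≤ ‖y‖ * ‖v y‖ + ‖y‖ * ‖v y‖ := add_le_add hA hB
    _ = 2 * (‖y‖ * ‖v y‖) := by ring

/-- **SAFFMAN'S IMPULSE IDENTITY (3.2.11), component `i`, for integrable fields**: for `v ∈ C¹(ℝ³; ℝ³)` with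
`v` and `x ↦ (x × curl v)ᵢ` integrable, `∫ (x × curl v)ᵢ dx = 2 ∫ vᵢ dx` (no divergence condition).
[cite: Saffman1992, §3.2 eq. (3.2.11)] -/
theorem integral_cross_curl_apply_eq_two_mul_integral (hv : ContDiff ℝ 1 v) (hint : Integrable v)
    (i : Fin 3) (hI : Integrable fun x => cross x (curl v x) i) :
    ∫ x, cross x (curl v x) i = 2 * ∫ x, v x i := by
  set G : EuclideanSpace ℝ (Fin 3) → EuclideanSpace ℝ (Fin 3) := fun y =>
    ⟪y, v y⟫ • (EuclideanSpace.single i (1 : ℝ) : EuclideanSpace ℝ (Fin 3)) - (v y i) • y with hGdef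
  have hG1 : ContDiff ℝ 1 G :=
    ((contDiff_id.inner ℝ hv).smul contDiff_const).sub ((contDiff_apply_coord_vec3 hv i).smul contDiff_id)
  have hdivG : (fun x => VectorCalculus.divergence G x) = fun x => cross x (curl v x) i - 2 * v x i :=
    funext fun x => divergence_impulseFlux_eq ((hv.differentiable one_ne_zero) x) i
  have hvi : Integrable fun x => v x i := integrable_apply_coord_vec3' hint i
  have hdI : Integrable fun x => VectorCalculus.divergence G x := by
    rw [hdivG]; exact hI.sub (hvi.const_mul 2)
  have hwI : Integrable fun x => ‖G x‖ / (1 + ‖x‖) := by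
    refine (hint.norm.const_mul 2).mono' ?_ (Eventually.of_forall fun x => ?_)
    · exact ((hG1.continuous.norm).div (continuous_const.add continuous_norm)
        fun x => (by positivity : (1 : ℝ) + ‖x‖ ≠ 0)).aestronglyMeasurable
    · have h1 : 0 < 1 + ‖x‖ := by positivity
      rw [Real.norm_of_nonneg (by positivity), div_le_iff₀ h1]
      calc ‖G x‖ ≤ 2 * (‖x‖ * ‖v x‖) := norm_impulseFlux_le v i x
        _ ≤ 2 * ‖v x‖ * (1 + ‖x‖) := by nlinarith [norm_nonneg x, norm_nonneg (v x)]
  have h := PineauVicol2026.integral_divergence_eq_zero_of_integrable_div hG1 hwI hdI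
  rw [hdivG, integral_sub hI (hvi.const_mul 2), integral_const_mul] at h
  linarith

/-- A component of the Bochner integral of an `ℝ³`-valued field is the integral of the component.
[folklore] -/
private theorem integral_apply_coord_vec3 {f : EuclideanSpace ℝ (Fin 3) → EuclideanSpace ℝ (Fin 3)}
    (hf : Integrable f) (i : Fin 3) : (∫ x, f x) i = ∫ x, f x i :=
  ((EuclideanSpace.proj i : EuclideanSpace ℝ (Fin 3) →L[ℝ] ℝ).integral_comp_comm hf).symm

/-- **SAFFMAN'S IMPULSE IDENTITY (3.2.11), vector form, for integrable fields**: for `v ∈ C¹(ℝ³; ℝ³)`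
with `v` and `x ↦ x × curl v(x)` integrable, `∫ x × curl v dx = 2 ∫ v dx` — the surface term
`∮ x × (n × v) dS` dies along large spheres. NO divergence condition. [cite: Saffman1992, §3.2 eq. (3.2.11)] -/
theorem integral_cross_curl_eq_two_smul_integral (hv : ContDiff ℝ 1 v) (hint : Integrable v)
    (hI : Integrable fun x => cross x (curl v x)) :
    ∫ x, cross x (curl v x) = (2 : ℝ) • ∫ x, v x := by
  ext i
  rw [integral_apply_coord_vec3 hI i, PiLp.smul_apply, integral_apply_coord_vec3 hint i, smul_eq_mul]
  exact integral_cross_curl_apply_eq_two_mul_integral hv hint i (integrable_apply_coord_vec3' hI i)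

/-- **THE HYDRODYNAMIC IMPULSE OF AN INTEGRABLE DIVERGENCE-FREE FIELD VANISHES** (Saffman (3.2.13) with
(3.2.15): `∫ u = ½ ∫ x × ω + surface` and `∫ u = 0`): for `v ∈ C¹(ℝ³; ℝ³)` divergence free with `v` and
`x × curl v` integrable, `I = ½ ∫ x × curl v dx = 0`. A field of non-zero impulse (a vortex ring, Hill's
vortex, any impulsively generated flow, Saffman §3.3) is therefore never integrable: its far field is the
dipole `O(|I|/r³)` of (3.2.7)–(3.2.8). [cite: Saffman1992, §3.2 eqs. (3.2.8), (3.2.13), (3.2.15)] -/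
theorem integral_cross_curl_eq_zero_of_isDivFree (hv : ContDiff ℝ 1 v)
    (hdiv : VectorCalculus.IsDivFree v) (hint : Integrable v)
    (hI : Integrable fun x => cross x (curl v x)) : ∫ x, cross x (curl v x) = 0 := by
  rw [integral_cross_curl_eq_two_smul_integral hv hint hI,
    integral_eq_zero_of_isDivFree_of_integrable hv hdiv hint, smul_zero]

/-- The third component of `x × curl v` is the tree's `swirl (curl v)` (`x₀ω₁ − x₁ω₀`), so the axial
statements of this file are the `i = 2` instances of the vector ones. [folklore] -/
private theorem cross_curl_apply_two (v : EuclideanSpace ℝ (Fin 3) → EuclideanSpace ℝ (Fin 3))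
    (x : EuclideanSpace ℝ (Fin 3)) : cross x (curl v x) 2 = swirl (curl v) x := by
  simp [cross, cross_apply, swirl]

end Vector

end Literature.Analysis.FluidPDE

end
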